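import Summits.AnomalousDissipation.AnomalousDissipation.Theses.FrustratedForces
import Summits.AnomalousDissipation.AnomalousDissipation.Theorems.EnsembleRigidityDefs
import HarnessLib

/-!
# Birth skeleton (BC3) — crux `FrustratedForces.GPLoudEnergyCeilingZ` (stmt-AnomalousDissipation-13924)

Route `route-AnomalousDissipation-FrustratedForces`, crux #3 (LOUD-SELECTIVE ν-UNIFORM ENERGY CEILING ON
`H` FOR THE GALLOWAY–PROCTOR FORCE): for every loudness floor `ε₀ > 0` there is `E` such that for all
`ν ∈ (0,1]`, every global Leray–Hopf solution `u` of `NS_ν(f_GP)` from a ZERO-MEAN datum with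
`meanDissipation ν u ≥ ε₀` has `meanEnergy u ≤ E` (`⟨·⟩ = limsup` of Cesàro means; hypothesis `hC` of
the route's deciding theorem `closes`).

This file is the route-level BIRTH CERTIFICATE skeleton of the crux (LENSES-v3 §2 BC3; registrar seat
`planner-skel-stmt-AnomalousDissipation-13924-0`, 2026-08-17, route re-audit bin REPAIRABLE). It types the
route header's own proof map for this crux ("TWO-LAYER PLAN. GPLoudEnergyCeilingZ ⇐ GPLoudEnsembleCeiling →
GPLoudEnergyCeilingZ, glue-by a loud-selective EnsembleCeilingBridgeZ"; "its statistical rung … the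
loud-selective twin of EnsembleCeilingBridgeZ"; "the statistical-level rung of #2") as THREE NAMED PIECES
and a kernel-checked composition, and repairs one point of that map on the way (the seam below).

## The seam: STATICS (stationary statistical solutions of `f_GP`) × DYNAMICS (one convexity bridge)

The crux couples two `limsup`s of ONE trajectory — `meanEnergy u` (hot epochs) and `meanDissipation ν u`
(loud epochs) — which need not be attained along the same sequence of averaging times. A naive
loud-selective bridge ("a loud trajectory has a loud time-average measure, a hot one a hot measure")
therefore does NOT reduce the crux to the ensemble statement "loud stationary statistical solutions are
cold": an intermittent trajectory could alternate quiet-hot and loud-cold epochs. The repair is CONVEXITY: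
generalized (Banach) limits form a convex set and `Λ ↦ μ_Λ` (time-average measure) is affine, so the
half-half mixture of a `limsup`-energy-attaining limit `Λ_hot` and a `limsup`-dissipation-attaining limit
`Λ_loud` is again a time-average measure `μ_m` of the SAME trajectory, hence (FMRT IV Thm. 3.1) a stationary
statistical solution, with work `∫(f_GP,v)dμ_m ≥ ½ Λ_loud⟨ν‖∇u‖²⟩ ≥ ε₀/2` (Leray–Hopf energy inequality
averaged: dissipation mean ≤ work mean + ‖u₀‖²/2T; the work of `Λ_hot` is ≥ 0 the same way) and energy
`∫|v|²dμ_m ≥ ½ Λ_hot⟨|u|²⟩ = ½ meanEnergy u`. So the ensemble ceiling at threshold `ε₀/2` bounds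
`meanEnergy u ≤ 2E`: the factor-2 losses are the price of decoupling the two `limsup`s, and the bridge
becomes a THEOREM-SIZED stub (most of its machinery is landed, see `stub_gpLoudEnsembleBridge`).

The static side — "work-loud stationary statistical solutions of `f_GP` are uniformly cold" (`C⁺ =
Sig.GPLoudEnsembleCeiling`, the transfer target; easier than the crux because ensembles carry no dynamics:
compactness / rescaling (`RescaledSkeletonSSS`, stmt-2983) and test-functional (Liouville) identities apply
to them directly) — is cut by ENERGY REGIME, and the cut is tight (each piece is implied by `C⁺`, and they
give it back by a case split):

* `stub_gpSubGrashofEnsembles` (S1, GRASHOF REGIME `a = 1`; the statistical rung of crux #2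
  `GPSteadySubGrashof`): for every Grashof fraction `c > 0` there is `ν₀ > 0` below which EVERY stationary
  statistical solution of `NS_ν(f_GP)` has `ν²·∫|v|²dμ ≤ c`. NECESSARY for `C⁺`: a Grashof-scale ensemble
  (`ν²e(μ) ≥ c`) is automatically loud — `∫(f,v)dμ ≥ ν∫‖∇v‖²dμ ≥ 4π²ν e(μ) ≥ 4π²c/ν → ∞` (energy
  inequality (1.32) + Poincaré) — and hot, so it would kill `C⁺` and the crux (this is the route's kill
  criterion `¬#2 ⇒ ¬#3`: the resonant control, Kolmogorov forcing, is loud AND hot, `LaminarCalibration`).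
  Mechanism: `RescaledSkeletonSSS` turns a violating sequence into a unit-energy finite-enstrophy stationary
  statistical solution of unforced Euler positively resonant with `f_GP`; frustration (Livšic/Newcomb
  solvability on the ABC₁₁₁ skeletons, lift-up on shear skeletons) must exclude it.
* `stub_gpLoudSubGrashofEnsemblesCold` (S2, INTERMEDIATE REGIME `a ∈ (0,1)`): for every `ε₀ > 0` there is a
  Grashof fraction `c(ε₀) > 0` such that, for every `ν₀ > 0`, the work-loud (`∫(f_GP,v)dμ ≥ ε₀`) stationary
  statistical solutions at `ν ≤ 1` that are sub-Grashof (`ν²e(μ) ≤ c`) whenever `ν < ν₀` have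
  `e(μ) ≤ E(ε₀, ν₀)`. For `ν ∈ [ν₀, 1]` this is the a-priori bound `e(μ) ≤ ‖f_GP‖²/(16π⁴ν₀²)` (FMRT IV
  (1.32)–(1.34); tree: `ensembleDissipation_le_of_isStationary_holds`, `energy_le_holds`,
  `enorm_sq_le_eGradNormSq`); the content is `ν < ν₀`: no loud ensemble of `f_GP` lives at an
  intermediate scaling `E ≍ ν^{-2a}`, `0 < a < 1` (the crux's own "why it might fail": an off-ladder hot-loud
  state; the census' warm ends `a = 1/3` are QUIET, loudness ×0.80 per octave, so they leave the loud class).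
* `stub_gpLoudEnsembleBridge` (B, DYNAMICS → STATICS at FIXED `ν`, zero-mean data): if every stationary
  statistical solution of `NS_ν(f_GP)` with work `≥ ε₀/2` has energy `≤ E`, then every global Leray–Hopf
  solution from a zero-mean datum with `meanDissipation ≥ ε₀` has `meanEnergy ≤ 2E` (the convexity bridge
  above). Leans on LANDED lemmas: `Theorems.exists_generalizedLimit_of_ultrafilter`,
  `Theorems.exists_generalizedLimit_apply_eq_limsup`, `Theorems.exists_isTimeAverageMeasure_of_memLp`,
  `Torus.IsTimeAverageMeasure.{lintegral_eGradNormSq_lt_top, integrable_generator_and_integral_eq_zero,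
  energy_ineq_shell, integral_eq_of_eqOn}`, `Torus.IsGlobalLerayHopf.exists_forall_lift_mem_closedBall`
  (all behind `Theorems/TaylorCertificatesEnsembleCeilingTransfer.lean`, `meanEnergy_le_of_ensembleCeiling`);
  still to do: the `H`-lift of a Leray–Hopf path from a MEAN-ZERO datum (zero mean is conserved,
  `IsGlobalLerayHopf.integral_inner_const_eq`), the average of two generalized limits as a
  `GeneralizedLimit`, the work observable `v ↦ (v, f_GP)` on the carrying ball, and the Cesàro-averaged
  energy inequality `T⁻¹ν∫₀ᵀ‖∇u‖² ≤ ‖u₀‖²/(2T) + T⁻¹∫₀ᵀ(f_GP,u)` (`energy_ineq_zero`). Size M–L, provable now.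
* `gpLoudEnsembleCeiling_of_pieces : S1-sig → S2-sig → C⁺` and
  `GPLoudEnergyCeilingZ_of : S1-sig → S2-sig → B-sig → GPLoudEnergyCeilingZ` — SORRY-FREE (axioms
  `propext`, `Classical.choice`, `Quot.sound`): given `ε₀`, take `c` from S2 at `ε₀/2`, `ν₀` from S1 at `c`,
  `E` from S2 at `ν₀`; then B at threshold `ε₀` with the ensemble ceiling at `ε₀/2` gives `2E`. The crux's
  inline force is `gpForce` by `rfl` (`Theorems.EnsembleRigidity.gpForce_eq`), so the Leray–Hopf hypothesis of
  the crux is passed to B unchanged.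
* `GPLoudEnergyCeilingZ_proof : GPLoudEnergyCeilingZ` — the skeleton in its final shape (the crux BY NAME
  from the three registered stubs; `sorryAx` only through them).

## What the skeleton honours (negatives, crux-attack, barriers; no `Disproof.lean` exists for this crux)

* Negatives index (2026-08-17): the two refuted statements of this route are ANY-MEAN (stmt-2979
  `GPEnergyCeiling`, stmt-2984 `EnsembleCeilingBridge`; Galilean-drift / constant data, `f = 0`). B keeps
  the crux's `HasZeroMean u₀` verbatim and pins `f = f_GP ≠ 0`; S1/S2 live on `H` (mean-zero by definition
  of `Torus.energySpace`). No stub is an instance of a refuted statement.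
* Crux-attack (refuter, 2026-08-15): "resonant-force analogue false ⇒ proof must use frustration" — S1
  and S2 are stated for the pinned `f_GP` only and are FALSE for the Kolmogorov shear force (laminar state,
  `LaminarCalibration`: `ν²‖u‖² ≡ 1/(32π⁴)`, loud and hot); B is force-robust (and would hold for any steady
  `L²` force), as a bridge should be.
* Barriers (route catalogue): `Marchioro1986_globalAttraction` — S1 is exactly the statement that fails
  for first-mode Euler-steady forces, so it is force-specific on purpose; `AlexakisDoering2006` (2-D: loud
  ⇒ hot) — S2 is genuinely 3-D; `Cheskidov2023_thm13` — nothing here perturbs the force.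

## BC3 probes (registrar folder `bc/probe_*.lean`; imports: route file + `EnsembleRigidityDefs` only)

For each stub `X ∈ {S1, S2, B}` (its `Sig` pasted as a closed Prop): `example : X → GPLoudEnergyCeilingZ`
and `example : X → AnomalousDissipation` by `first | exact? | simpa [X] | (unfold X; simpa) | aesop`, and the
hypothesis form with both sides unfolded by `first | exact? | simpa using h | aesop`, all under
`set_option maxHeartbeats 400000` — ALL 12 FAIL (unsolved goals after `aesop: failed to prove the goal after
exhaustive search`, `exact?`/`simpa` failing inside `first`; the unfolded summit probes time out at `whnf`);
for B each alternative was also run ALONE (9 runs): `exact?` "could not close the goal" ×3, `simpa` type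
mismatch / `assumption` failed ×3, `aesop` exhaustive-search failure ×2 and one `whnf` timeout. No stub is
cheaply the crux or the summit: S1 and S2 speak of stationary statistical solutions only (no Leray–Hopf
trajectory, no `meanEnergy`), B is a conditional at fixed `ν` whose hypothesis is the open ensemble ceiling.

## References

* C. Foias, O. Manley, R. Rosa, R. Temam, *Navier–Stokes Equations and Turbulence* (CUP 2001), Ch. IV
  §1.2 Def. 1.3, (1.29)–(1.34); §1.3 Def. 1.4 (generalized limits); §3.1 Prop. 3.1, Cor. 3.1, Thm. 3.1
  (time-average measures are stationary statistical solutions). [FoiasManleyRosaTemam2001]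
* C. R. Doering, C. Foias, J. Fluid Mech. 467 (2002) §§2–3. [DoeringFoias2002]
* L. T. Hoang, M. S. Jolly, arXiv:2402.13346, Thm. 4.3/4.5/4.7 (Grashof expansions of steady states);
  C. Foias, L. Hoang, M. Jolly, doi:10.3934/cpaa.2024010. [HoangJolly2024, FoiasHoangJolly2024]
* A. Cheskidov, arXiv:2311.04182 §1.2. [Cheskidov2023]
* A. Alexakis, C. R. Doering, Phys. Lett. A 359 (2006). [AlexakisDoering2006PLA]
-/

-- `Summit.<Summit>.<Problem>` repeats the summit = sub-problem segment (D-0017 layout; single-conjunct summit).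
set_option linter.dupNamespace false

noncomputable section

namespace Summit.AnomalousDissipation.AnomalousDissipation.Cruxes.GPLoudEnergyCeilingZ.Birth

open MeasureTheory Filter Topology
open scoped InnerProductSpace RealInnerProductSpace ENNReal NNReal
open Literature.Analysis.FunctionSpaces Literature.Analysis.FluidPDE
open Summit.AnomalousDissipation.AnomalousDissipation.Theses.FrustratedForces
open Summit.AnomalousDissipation.AnomalousDissipation.Theorems.EnsembleRigidity (gpForce gpForce_eq)

/-- Local notation: the flat unit three-torus. -/
local notation "𝕋³" => UnitAddTorus (Fin 3)
/-- Local notation: velocity values. -/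
local notation "E³" => EuclideanSpace ℝ (Fin 3)
/-- Local notation: `L²(T³; ℝ³)`. -/
local notation "L2" => (Lp (EuclideanSpace ℝ (Fin 3)) 2 (volume : Measure (UnitAddTorus (Fin 3))))
/-- Local notation: the energy space `H = L²_σ(T³)` (mean-zero, divergence-free `L²` classes). -/
local notation "H3" => (Torus.energySpace (Fin 3))

/-! ## The transfer target `C⁺` (ensemble level; NOT a stub) -/

/-- **`C⁺ = GPLoudEnsembleCeiling`** — the ensemble-level form of the crux (the route header's foreseen
node "GPLoudEnsembleCeiling"): for every `ε₀ > 0` there is `E` such that for all `ν ∈ (0,1]` every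
stationary statistical solution `μ` of `NS_ν(f_GP)` (FMRT IV Def. 1.3, on `H`) with integrable energy and
work `∫ (v, f_GP) dμ(v) ≥ ε₀` has `∫ |v|² dμ ≤ E`. Loudness is measured by the WORK `∫(f_GP,v)dμ`, which
dominates the ensemble dissipation `ν∫‖∇v‖²dμ` (energy inequality (1.32), `energy_le_holds`) and is the
functional that passes exactly from trajectories to time-average measures. Reached from S1 and S2 by
`gpLoudEnsembleCeiling_of_pieces`; turned into the crux by the bridge B. -/
def Sig.GPLoudEnsembleCeiling : Prop :=
  ∀ ε₀ : ℝ, 0 < ε₀ → ∃ E : ℝ, ∀ ν : ℝ, 0 < ν → ν ≤ 1 → ∀ μ : Measure H3,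
    Torus.IsStationaryStatisticalSolution ν gpForce μ → Integrable (fun u : H3 => ‖u‖ ^ 2) μ →
    ε₀ ≤ ∫ u, Torus.pairing (u : L2) gpForce ∂μ → Torus.ensembleEnergy μ ≤ E

/-! ## Stub signatures (`Sig.stub_*`; the registered stubs below assert exactly these) -/

/-- STUB S1 — SUB-GRASHOF CEILING OVER ALL STATIONARY STATISTICAL SOLUTIONS OF `f_GP` (Grashof regime,
`a = 1`; the statistical rung of crux #2 `GPSteadySubGrashof`, which is its Dirac instance at steady states).
For every Grashof fraction `c > 0` there is `ν₀ > 0` such that for `0 < ν < ν₀` every stationary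
statistical solution `μ` of `NS_ν(f_GP)` with integrable energy has `ν² · ∫|v|²dμ ≤ c`. Trivial for
`c ≥ ‖f_GP‖²/(16π⁴) = 3/(32π⁴)` (a-priori bound (1.34)); the content is small `c`: no statistical state of
the frustrated force hoards Grashof-scale energy. FALSE for resonant (Stokes-eigen AND Euler-steady)
forces (`LaminarCalibration`). Mechanism: `RescaledSkeletonSSS` (stmt-2983) + exclusion of positively
resonant finite-enstrophy Euler statistics of `f_GP` (Livšic/Newcomb on ABC₁₁₁, lift-up on shears).
Size: open (shares the risk of #2: a resonant `a = 1` branch kills both — route kill criterion). -/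
def Sig.stub_gpSubGrashofEnsembles : Prop :=
  ∀ c : ℝ, 0 < c → ∃ ν₀ : ℝ, 0 < ν₀ ∧ ∀ ν : ℝ, 0 < ν → ν < ν₀ → ∀ μ : Measure H3,
    Torus.IsStationaryStatisticalSolution ν gpForce μ → Integrable (fun u : H3 => ‖u‖ ^ 2) μ →
    ν ^ 2 * Torus.ensembleEnergy μ ≤ c

/-- STUB S2 — WORK-LOUD ENSEMBLES OF `f_GP` BELOW A GRASHOF FRACTION ARE UNIFORMLY COLD (intermediate
regime, `0 < a < 1`). For every loudness floor `ε₀ > 0` there is a Grashof fraction `c > 0` such that for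
every `ν₀ > 0` there is `E` with: for all `ν ∈ (0,1]`, every stationary statistical solution `μ` of
`NS_ν(f_GP)` with integrable energy, which is sub-Grashof (`ν²∫|v|²dμ ≤ c`) in case `ν < ν₀`, and whose
work is `∫(v,f_GP)dμ ≥ ε₀`, has `∫|v|²dμ ≤ E`. The range `ν ∈ [ν₀,1]` is the a-priori bound
`∫|v|²dμ ≤ ‖f_GP‖²/(16π⁴ν₀²)` (FMRT IV (1.32)–(1.34): `ensembleDissipation_le_of_isStationary_holds`,
`energy_le_holds`, Poincaré `enorm_sq_le_eGradNormSq`); the content is `ν < ν₀`: a loud ensemble cannot sit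
at an intermediate scaling `∫|v|²dμ ≍ ν^{-2a}`, `0 < a < 1` (the crux's "off-ladder hot-loud state").
Nothing in print (DoeringFoias2002 bounds ε by U, never U by ε). Size: open. -/
def Sig.stub_gpLoudSubGrashofEnsemblesCold : Prop :=
  ∀ ε₀ : ℝ, 0 < ε₀ → ∃ c : ℝ, 0 < c ∧ ∀ ν₀ : ℝ, 0 < ν₀ → ∃ E : ℝ, ∀ ν : ℝ, 0 < ν → ν ≤ 1 →
    ∀ μ : Measure H3, Torus.IsStationaryStatisticalSolution ν gpForce μ →
    Integrable (fun u : H3 => ‖u‖ ^ 2) μ →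
    (ν < ν₀ → ν ^ 2 * Torus.ensembleEnergy μ ≤ c) →
    ε₀ ≤ ∫ u, Torus.pairing (u : L2) gpForce ∂μ → Torus.ensembleEnergy μ ≤ E

/-- STUB B — THE LOUD-SELECTIVE CONVEXITY BRIDGE (dynamics → statics at FIXED `ν > 0`, zero-mean data;
the loud-selective twin of the support `EnsembleCeilingBridgeZ`, stmt-10437). If every stationary
statistical solution of `NS_ν(f_GP)` with integrable energy and work `≥ ε₀/2` has energy `≤ E`, then every
global Leray–Hopf solution `u` of `NS_ν(f_GP)` from a ZERO-MEAN datum with `meanDissipation ν u ≥ ε₀` has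
`meanEnergy u ≤ 2E`. Proof sketch (FMRT IV §1.3, §3.1; all named lemmas LANDED unless marked TODO): lift
`u` to `U : ℝ → H` (TODO: zero mean conserved, `IsGlobalLerayHopf.integral_inner_const_eq`); `U` stays in a
ball (`IsGlobalLerayHopf.exists_forall_lift_mem_closedBall`), so the Cesàro means of `|U|²`, of the work
`(U, f_GP)` and of the dissipation are eventually bounded; pick generalized limits `Λ_hot`, `Λ_loud`
attaining `limsup` of the energy means resp. of the dissipation means
(`Theorems.exists_generalizedLimit_apply_eq_limsup`); their average `Λ_m` is a generalized limit (TODO,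
3 lines of structure); its time-average measure `μ_m` exists (`Theorems.exists_isTimeAverageMeasure_of_memLp`)
and is a stationary statistical solution (`Torus.IsTimeAverageMeasure.lintegral_eGradNormSq_lt_top`,
`…integrable_generator_and_integral_eq_zero`, `…energy_ineq_shell`); on the carrying ball
`∫|v|²dμ_m = Λ_m⟨|U|²⟩ ≥ ½ meanEnergy u` and `∫(v,f_GP)dμ_m = Λ_m⟨(U,f_GP)⟩ ≥ ½ Λ_loud⟨ν‖∇u‖²⟩ = ½
meanDissipation ν u ≥ ε₀/2` (`…integral_eq_of_eqOn`; TODO: Cesàro-averaged `energy_ineq_zero`,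
`T⁻¹ν∫₀ᵀ‖∇u‖² ≤ ‖u₀‖²/(2T) + T⁻¹∫₀ᵀ(f_GP,u)`, and positivity `Λ.longTimeAvg_nonneg`). Size M–L, provable now. -/
def Sig.stub_gpLoudEnsembleBridge : Prop :=
  ∀ ν E ε₀ : ℝ, 0 < ν → 0 < ε₀ →
    (∀ μ : Measure H3, Torus.IsStationaryStatisticalSolution ν gpForce μ →
      Integrable (fun u : H3 => ‖u‖ ^ 2) μ →
      ε₀ / 2 ≤ ∫ u, Torus.pairing (u : L2) gpForce ∂μ → Torus.ensembleEnergy μ ≤ E) →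
    ∀ (u₀ : 𝕋³ → E³) (u : ℝ → 𝕋³ → E³), Torus.HasZeroMean u₀ →
      Torus.IsGlobalLerayHopf ν (fun _ => gpForce) u₀ u →
      ε₀ ≤ meanDissipation ν u → meanEnergy u ≤ 2 * E

/-! ## Registered stubs -/

/-- Registered stub S1 — sub-Grashof ceiling over all stationary statistical solutions of `f_GP`
(Grashof regime; statistical rung of crux #2; open). -/
theorem stub_gpSubGrashofEnsembles : Sig.stub_gpSubGrashofEnsembles := by
  sorry

/-- Registered stub S2 — work-loud sub-Grashof ensembles of `f_GP` are uniformly cold (intermediate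
regime; open). -/
theorem stub_gpLoudSubGrashofEnsemblesCold : Sig.stub_gpLoudSubGrashofEnsemblesCold := by
  sorry

/-- Registered stub B — the loud-selective convexity bridge from Leray–Hopf trajectories with zero-mean
data to stationary statistical solutions, at fixed viscosity (provable now, size M–L). -/
theorem stub_gpLoudEnsembleBridge : Sig.stub_gpLoudEnsembleBridge := by
  sorry

/-! ## Composition (sorry-free) -/

/-- **The two ensemble stubs give the ensemble ceiling `C⁺`** (case split by energy regime): given `ε₀`,
take the Grashof fraction `c` of S2, the threshold viscosity `ν₀` of S1 at `c`, and the bound `E` of S2 at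
`ν₀`; a loud ensemble at `ν < ν₀` is sub-Grashof by S1, so S2 applies at every `ν ∈ (0,1]`. -/
theorem gpLoudEnsembleCeiling_of_pieces (h₁ : Sig.stub_gpSubGrashofEnsembles)
    (h₂ : Sig.stub_gpLoudSubGrashofEnsemblesCold) : Sig.GPLoudEnsembleCeiling := by
  intro ε₀ hε₀
  obtain ⟨c, hc, h₂'⟩ := h₂ ε₀ hε₀
  obtain ⟨ν₀, hν₀, h₁'⟩ := h₁ c hc
  obtain ⟨E, hE⟩ := h₂' ν₀ hν₀
  exact ⟨E, fun ν hν hν1 μ hμ hint hW =>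
    hE ν hν hν1 μ hμ hint (fun hlt => h₁' ν hν hlt μ hμ hint) hW⟩

/-- **The line closes the crux BY NAME modulo the three registered stubs** (sorry-free; the implication
content of the skeleton; hypothesis heads = registered stub signatures). Given `ε₀ > 0`, the ensemble ceiling
`C⁺` at `ε₀/2` gives `E`; answer `2E`: for `ν ∈ (0,1]` and a loud zero-mean Leray–Hopf solution the bridge B
applies with the ensemble ceiling as its hypothesis (the crux's inline force is `gpForce` by `rfl`). -/
theorem GPLoudEnergyCeilingZ_of :
    Sig.stub_gpSubGrashofEnsembles → Sig.stub_gpLoudSubGrashofEnsemblesCold →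
      Sig.stub_gpLoudEnsembleBridge → GPLoudEnergyCeilingZ := by
  intro h₁ h₂ hB ε₀ hε₀
  obtain ⟨E, hE⟩ := gpLoudEnsembleCeiling_of_pieces h₁ h₂ (ε₀ / 2) (half_pos hε₀)
  refine ⟨2 * E, fun ν hν hν1 u₀ u hz hLH hloud => ?_⟩
  exact hB ν E ε₀ hν hε₀ (fun μ hμ hint hW => hE ν hν hν1 μ hμ hint hW) u₀ u hz hLH hloud

/-- The skeleton in its final shape (D-0027 §3.3): the crux BY NAME from the three registered stubs; it
becomes the crux proof when the last `stub_*` is discharged (until then it depends on `sorryAx` through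
the stubs only — no `sorry` of its own). -/
theorem GPLoudEnergyCeilingZ_proof : GPLoudEnergyCeilingZ :=
  GPLoudEnergyCeilingZ_of stub_gpSubGrashofEnsembles stub_gpLoudSubGrashofEnsemblesCold
    stub_gpLoudEnsembleBridge

end Summit.AnomalousDissipation.AnomalousDissipation.Cruxes.GPLoudEnergyCeilingZ.Birth

end
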